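import Mathlib.RingTheory.AlgebraicIndependent.TranscendenceBasis
import Mathlib.FieldTheory.IntermediateField.Adjoin.Basic
import Mathlib.FieldTheory.AlgebraicClosure
import Mathlib.Analysis.SpecialFunctions.Complex.Log
import Mathlib.LinearAlgebra.Matrix.Rank
import Mathlib.LinearAlgebra.Basis.VectorSpace
import Mathlib.LinearAlgebra.FiniteDimensional.Lemmas
import Literature.NumberTheory.Transcendental.QuadraticRelationsLogarithms
import Literature.NumberTheory.Transcendental.LindemannWeierstrassProofs
import HarnessLib

/-!
# Quadratic relations between logarithms (Roy–Waldschmidt 1997): descent and rank lemmas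

Sibling support file of `QuadraticRelationsLogarithms.lean` for the deduction of Roy–Waldschmidt's
Théorème 0.2 (`Literature.NumberTheory.Transcendental.royWaldschmidt_quadratic_thm_0_2`) from their
Théorème 0.1 (file `QuadraticRelationsLogarithmsThm01.lean`), i.e. the linear algebra of §7,
p. 791 and p. 795 of D. Roy, M. Waldschmidt, *Approximation diophantienne et indépendance
algébrique de logarithmes*, Ann. Sci. ÉNS (4) 30 (1997).  Everything is PROVED; no named facts.

* `isAlgebraic_cexp_sum_rat_mul` — `𝓛 = exp⁻¹(ℚ̄^×)` is a `ℚ`-vector space: exponentials of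
  rational combinations of logarithms of algebraic numbers are algebraic ("on écrit `𝓛` pour
  désigner le `ℚ`-espace vectoriel `𝓛_ℚ̄`", p. 754).
* `eq_zero_of_isAlgebraic_of_isAlgebraic_cexp` — Hermite–Lindemann in the form used on p. 791:
  an algebraic logarithm of an algebraic number is `0` (tree: `transcendental_exp_holds`).
* `trdeg_eq_zero_or_eq_one` — `¬ 2 ≤ trdeg ⇒ trdeg = 0 ∨ trdeg = 1`.
* `trdeg_restrictScalars_adjoin_of_isAlgebraic` — adjoining algebraic numbers does not change the
  transcendence degree ("K est contenu dans une extension algébrique du corps K₀ … il en va de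
  même de K", p. 791).
* `exists_comap_eq_ratSpan` — the preimage of a subspace of matrices defined over `ℚ` under a
  linear map `w ↦ ∑ wₖ Cₖ` with rational `Cₖ` is defined over `ℚ` ("`U = θ⁻¹(T)` … est défini sur
  `ℚ` car `θ` est défini sur `ℚ`", p. 795), by descent of coefficient vectors in a `ℚ`-basis of `ℂ`.
* `two_mul_rank_le_of_mul_self_eq_zero`, `rank_eq_card_of_mul_self_eq_smul_one` — `M² = 0 ⇒
  2·rank M ≤ D` and `M² = c·1, c ≠ 0 ⇒ rank M = D` ("Comme `det(M) = 0`, son rang est `< N`",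
  p. 795, and (7.3) p. 793).

## References

* [RoyWaldschmidt1997ENS] D. Roy, M. Waldschmidt, Ann. Sci. ÉNS (4) 30 (1997) 753–796, §7,
  pp. 791–795 (lit key paper:doi-10-1016-s0012-9593-97-89938-7).
-/

noncomputable section

open Complex IntermediateField

namespace Literature.NumberTheory.Transcendental

namespace RoyWaldschmidt1997

/-! ### `𝓛` is a `ℚ`-vector space -/

/-- **`𝓛` is a `ℚ`-subspace of `ℂ`**: if all `e^{lₖ}` are algebraic then `e^{∑ cₖ lₖ}` is
algebraic for rational `cₖ` (`e^{z/q}` is a `q`-th root of `e^z`; the one-term case is the tree's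
`Literature.Barriers.Schanuel.isAlgebraic_exp_rat_mul`, whose barrier file is not imported here to
keep the imports of this number-theory file light). [cite: RoyWaldschmidt1997ENS, §0 p. 754 (notation 𝓛)] -/
theorem isAlgebraic_cexp_sum_rat_mul {n : ℕ} {l : Fin n → ℂ} (hl : ∀ i, IsAlgebraic ℚ (cexp (l i)))
    (c : Fin n → ℚ) : IsAlgebraic ℚ (cexp (∑ k, (c k : ℂ) * l k)) := by
  -- one term: `e^{c z}` is algebraic when `e^z` is
  have one : ∀ {z : ℂ}, IsAlgebraic ℚ (cexp z) → ∀ c : ℚ, cexp ((c : ℂ) * z) ∈ algebraicClosure ℚ ℂ := by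
    intro z hz c
    -- `y = e^{z / den}` is algebraic: `y ^ den = e^z`
    set y : ℂ := cexp (z / (c.den : ℂ)) with hy
    have hden : (c.den : ℂ) ≠ 0 := by exact_mod_cast c.den_ne_zero
    have hyd : y ^ c.den = cexp z := by
      rw [hy, ← Complex.exp_nat_mul, mul_div_cancel₀ _ hden]
    have hyalg : IsAlgebraic ℚ y := IsAlgebraic.of_pow c.den_pos (hyd ▸ hz)
    have hymem : y ∈ algebraicClosure ℚ ℂ := mem_algebraicClosure_iff.mpr hyalg
    -- `e^{c z} = y ^ num`
    have hcz : cexp ((c : ℂ) * z) = y ^ c.num := by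
      rw [hy, ← Complex.exp_int_mul]
      congr 1
      have hc : (c : ℂ) = (c.num : ℂ) / (c.den : ℂ) := by
        rw [← Rat.cast_intCast, ← Rat.cast_natCast, ← Rat.cast_div, Rat.num_div_den]
      rw [hc]
      field_simp
    rw [hcz]
    exact zpow_mem hymem _
  rw [Complex.exp_sum]
  exact mem_algebraicClosure_iff.mp (prod_mem fun k _ => one (hl k) (c k))

/-- **Hermite–Lindemann, as used on p. 791**: a complex number which is algebraic together with
its exponential is `0` (tree: `transcendental_exp_holds`). [cite: RoyWaldschmidt1997ENS, §7 proof of Cor. 7.2 ("le théorème d'Hermite-Lindemann donne v = 0")] -/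
theorem eq_zero_of_isAlgebraic_of_isAlgebraic_cexp {z : ℂ} (hz : IsAlgebraic ℚ z)
    (he : IsAlgebraic ℚ (cexp z)) : z = 0 := by
  by_contra h
  exact transcendental_exp_holds hz h he

/-! ### Transcendence degree bookkeeping -/

/-- A transcendence degree which is not `≥ 2` is `0` or `1`. [folklore] -/
theorem trdeg_eq_zero_or_eq_one {t : Cardinal} (h : ¬ (2 : Cardinal) ≤ t) : t = 0 ∨ t = 1 := by
  rw [not_le] at h
  have hlt : t < Cardinal.aleph0 := h.trans (by exact_mod_cast Cardinal.natCast_lt_aleph0 (n := 2))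
  obtain ⟨m, rfl⟩ := Cardinal.lt_aleph0.mp hlt
  have hm : m < 2 := by exact_mod_cast h
  interval_cases m
  · left; simp
  · right; simp

/-- **Adjoining algebraic numbers does not change the transcendence degree**: for an intermediate
field `F` of `ℂ/ℚ` and a set `T` of algebraic numbers, `trdeg_ℚ F(T) = trdeg_ℚ F` (tower law,
`F(T)/F` algebraic). [folklore] -/
theorem trdeg_restrictScalars_adjoin_of_isAlgebraic (F : IntermediateField ℚ ℂ) {T : Set ℂ}
    (hT : ∀ x ∈ T, IsAlgebraic ℚ x) :
    Algebra.trdeg ℚ ((adjoin F T).restrictScalars ℚ) = Algebra.trdeg ℚ F := by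
  haveI : Algebra.IsAlgebraic F (adjoin F T) :=
    isAlgebraic_adjoin fun x hx => ((hT x hx).tower_top (L := F)).isIntegral
  have h := trdeg_add_eq ℚ F (A := adjoin F T)
  rw [trdeg_eq_zero (R := F) (A := adjoin F T), add_zero] at h
  calc Algebra.trdeg ℚ ((adjoin F T).restrictScalars ℚ) = Algebra.trdeg ℚ (adjoin F T) := rfl
    _ = Algebra.trdeg ℚ F := h.symm

/-! ### Rational subspaces: preimages -/

variable {n D : ℕ}

/-- The complexification `ℚ^{D×D} → ℂ^{D×D}` of matrices. [folklore] -/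
theorem map_ratCast_smul (c : ℚ) (A : Matrix (Fin D) (Fin D) ℚ) :
    (c • A).map (algebraMap ℚ ℂ) = (c : ℂ) • A.map (algebraMap ℚ ℂ) := by
  ext a b; simp

/-- Rational combinations of rational matrices complexify into `span_ℂ` of the complexified
matrices. [folklore] -/
theorem map_mem_span_of_mem_span {S : Set (Matrix (Fin D) (Fin D) ℚ)} {A : Matrix (Fin D) (Fin D) ℚ}
    (hA : A ∈ Submodule.span ℚ S) :
    A.map (algebraMap ℚ ℂ) ∈
      Submodule.span ℂ ((fun B : Matrix (Fin D) (Fin D) ℚ => B.map (algebraMap ℚ ℂ)) '' S) := by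
  induction hA using Submodule.span_induction with
  | mem x hx => exact Submodule.subset_span ⟨x, hx, rfl⟩
  | zero => simp
  | add x y _ _ hx hy =>
    have e : (x + y).map (algebraMap ℚ ℂ) = x.map (algebraMap ℚ ℂ) + y.map (algebraMap ℚ ℂ) := by
      ext a b; simp
    rw [e]; exact Submodule.add_mem _ hx hy
  | smul c x _ hx => rw [map_ratCast_smul]; exact Submodule.smul_mem _ _ hx

/-- **Preimages of subspaces defined over `ℚ` under maps defined over `ℚ` are defined over `ℚ`.**
Let `C₁, …, Cₙ` be rational `D × D` matrices, `Θ(w) = ∑ₖ wₖ Cₖ` on `ℂⁿ`, and `T` the `ℂ`-span of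
a set of rational matrices. Then `Θ⁻¹(T) = ratSpan s` for
`s = {v ∈ ℚⁿ | ∑ vₖ Cₖ ∈ span_ℚ S}`.  Proof: expand `w` in a `ℚ`-basis of `ℂ`; the coefficient
vectors `w_j ∈ ℚⁿ` of `w` satisfy `∑ₖ (w_j)ₖ Cₖ =` the `j`-th coefficient matrix of `Θ(w)`, which
lies in `span_ℚ S` when `Θ(w) ∈ span_ℂ S`. [cite: RoyWaldschmidt1997ENS, §7 (iii) p. 795 ("U = θ⁻¹(T) … est défini sur ℚ car θ est défini sur ℚ")] -/
theorem exists_comap_eq_ratSpan (C : Fin n → Matrix (Fin D) (Fin D) ℚ)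
    (S : Set (Matrix (Fin D) (Fin D) ℚ)) :
    ∃ s : Set (Fin n → ℚ), ∀ w : Fin n → ℂ,
      (∑ k, w k • (C k).map (algebraMap ℚ ℂ)) ∈
          Submodule.span ℂ ((fun B : Matrix (Fin D) (Fin D) ℚ => B.map (algebraMap ℚ ℂ)) '' S) ↔
        w ∈ ratSpan s := by
  classical
  let T : Submodule ℂ (Matrix (Fin D) (Fin D) ℂ) :=
    Submodule.span ℂ ((fun B : Matrix (Fin D) (Fin D) ℚ => B.map (algebraMap ℚ ℂ)) '' S)
  let Θ : (Fin n → ℂ) →ₗ[ℂ] Matrix (Fin D) (Fin D) ℂ :=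
    ∑ k, (LinearMap.proj k : (Fin n → ℂ) →ₗ[ℂ] ℂ).smulRight ((C k).map (algebraMap ℚ ℂ))
  have hΘ : ∀ w, Θ w = ∑ k, w k • (C k).map (algebraMap ℚ ℂ) := fun w => by
    simp [Θ, LinearMap.sum_apply]
  let s : Set (Fin n → ℚ) := {v | (∑ k, v k • C k) ∈ Submodule.span ℚ S}
  refine ⟨s, fun w => ?_⟩
  -- casts of elements of `s` are mapped into `T`
  have hcast : ∀ v : Fin n → ℚ, Θ (fun i => ((v i : ℚ) : ℂ)) = (∑ k, v k • C k).map (algebraMap ℚ ℂ) := by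
    intro v
    rw [hΘ]
    ext a b
    simp [Matrix.sum_apply]
  constructor
  · -- descent
    intro hw
    rw [← hΘ] at hw
    -- a `ℚ`-basis of `ℂ` and the coefficient vectors of `w`
    let c := Module.Basis.ofVectorSpace ℚ ℂ
    let wj : Module.Basis.ofVectorSpaceIndex ℚ ℂ → Fin n → ℚ := fun j k => c.repr (w k) j
    -- reconstruction of `w`
    have hrec : w = ∑ j ∈ Finset.univ.biUnion fun k => (c.repr (w k)).support,
        (c j) • fun k => ((wj j k : ℚ) : ℂ) := by
      funext i
      simp only [Finset.sum_apply, Pi.smul_apply, smul_eq_mul]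
      set S₀ := Finset.univ.biUnion fun k => (c.repr (w k)).support
      have hsub : (c.repr (w i)).support ⊆ S₀ := fun j hj =>
        Finset.mem_biUnion.mpr ⟨i, Finset.mem_univ _, hj⟩
      have h1 := c.linearCombination_repr (w i)
      rw [Finsupp.linearCombination_apply, Finsupp.sum_of_support_subset (c.repr (w i)) hsub
        (fun j a => a • c j) (fun j _ => zero_smul ℚ (c j))] at h1
      calc w i = ∑ j ∈ S₀, (c.repr (w i)) j • c j := h1.symm
        _ = ∑ j ∈ S₀, c j * ((wj j i : ℚ) : ℂ) := Finset.sum_congr rfl fun j _ => by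
            rw [Rat.smul_def, mul_comm]
    -- each coefficient vector lies in `s`
    have hmem : ∀ j, wj j ∈ s := by
      intro j
      -- the `j`-th coefficient matrix
      let π : Matrix (Fin D) (Fin D) ℂ →+ Matrix (Fin D) (Fin D) ℚ :=
        { toFun := fun N => Matrix.of fun a b => c.repr (N a b) j
          map_zero' := by ext a b; simp
          map_add' := fun N N' => by ext a b; simp }
      have hπ : ∀ (z : ℂ) (B : Matrix (Fin D) (Fin D) ℚ),
          π (z • B.map (algebraMap ℚ ℂ)) = (c.repr z j) • B := by
        intro z B
        ext a b
        simp only [π, AddMonoidHom.coe_mk, ZeroHom.coe_mk, Matrix.of_apply, Matrix.smul_apply,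
          Matrix.map_apply, smul_eq_mul, eq_ratCast]
        rw [show z * ((B a b : ℚ) : ℂ) = (B a b) • z by rw [Rat.smul_def, mul_comm], map_smul,
          Finsupp.smul_apply, smul_eq_mul, mul_comm]
      -- `π (Θ w) = ∑ (wj j)_k C_k`
      have h1 : π (Θ w) = ∑ k, wj j k • C k := by
        rw [hΘ, map_sum]
        exact Finset.sum_congr rfl fun k _ => hπ (w k) (C k)
      -- `π (Θ w) ∈ span_ℚ S`
      obtain ⟨lc, hlc, hsum⟩ := (Finsupp.mem_span_image_iff_linearCombination _).mp hw
      have h2 : π (Θ w) ∈ Submodule.span ℚ S := by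
        rw [← hsum, Finsupp.linearCombination_apply, Finsupp.sum, map_sum]
        refine Submodule.sum_mem _ fun B hB => ?_
        rw [hπ]
        exact Submodule.smul_mem _ _ (Submodule.subset_span (hlc hB))
      show (∑ k, wj j k • C k) ∈ Submodule.span ℚ S
      rw [← h1]
      exact h2
    rw [hrec]
    refine Submodule.sum_mem _ fun j _ => Submodule.smul_mem _ _ ?_
    exact Submodule.subset_span ⟨wj j, hmem j, rfl⟩
  · -- the easy inclusion
    intro hw
    rw [← hΘ]
    induction hw using Submodule.span_induction with
    | mem x hx =>
      obtain ⟨v, hv, rfl⟩ := hx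
      rw [hcast]
      exact map_mem_span_of_mem_span hv
    | zero => simp
    | add x y _ _ hx hy => rw [map_add]; exact T.add_mem hx hy
    | smul a x _ hx => rw [map_smul]; exact T.smul_mem a hx

/-! ### Ranks -/

/-- **`M² = 0 ⇒ 2 · rank M ≤ D`** (the image of `M` lies in its kernel; rank–nullity).
[folklore] -/
theorem two_mul_rank_le_of_mul_self_eq_zero (M : Matrix (Fin D) (Fin D) ℂ) (h : M * M = 0) :
    2 * M.rank ≤ D := by
  have hle : LinearMap.range M.mulVecLin ≤ LinearMap.ker M.mulVecLin := by
    rintro _ ⟨v, rfl⟩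
    rw [LinearMap.mem_ker, ← LinearMap.comp_apply, ← Matrix.mulVecLin_mul, h]
    simp
  have h1 := LinearMap.finrank_range_add_finrank_ker M.mulVecLin
  have h2 := Submodule.finrank_mono hle
  rw [Module.finrank_fin_fun] at h1
  unfold Matrix.rank
  omega

/-- **`M² = c · 1` with `c ≠ 0` ⇒ `rank M = D`** (`M` is invertible with inverse `c⁻¹ M`;
cf. (7.3) p. 793: "si `q(v) ≠ 0` … `M_v` est inversible, donc de rang `2^m`"). [cite: RoyWaldschmidt1997ENS, §7 (ii) (7.3), p. 793] -/
theorem rank_eq_of_mul_self_eq_smul_one (M : Matrix (Fin D) (Fin D) ℂ) {c : ℂ} (hc : c ≠ 0)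
    (h : M * M = c • (1 : Matrix (Fin D) (Fin D) ℂ)) : M.rank = D := by
  have h1 : M * (c⁻¹ • M) = 1 := by
    rw [Matrix.mul_smul, h, smul_smul, inv_mul_cancel₀ hc, one_smul]
  have h2 : (c⁻¹ • M) * M = 1 := by
    rw [Matrix.smul_mul, h, smul_smul, inv_mul_cancel₀ hc, one_smul]
  have hu : IsUnit M := ⟨⟨M, c⁻¹ • M, h1, h2⟩, rfl⟩
  simpa using Matrix.rank_of_isUnit M hu

end RoyWaldschmidt1997

end Literature.NumberTheory.Transcendental
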